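import Summits.QuantumFields.BalabanUV.Beta.WardMixedConsistency

/-!
# `BalabanUV.Beta.WardMixedWardModel` — binder row D1, (L4): **AN EXPLICIT MODEL OF THE hW MIXED WARD SOCKET** — the tree-gauge table
# `MW κ u ρ′ w := [cΛ • H_{ρ′w}, diagK (½Lc⁴ · χ_{path(root w → ·)}(κ,u))]` satisfies the level-0 mixed Ward letter (W-M₀) EXACTLY; its class and
# block translation (β sub-cell, D1 formalisation swarm, unit `b2b-balaban-beta-d1-formalise-leaf-06`, gen 4; «D1-hRhW-MIXED-JOINT-MODEL» part C1)

HONEST FRAMING (cell charter, verbatim): «discharging `BetaPertH` makes Bałaban's UV stability UNCONDITIONAL — a real constructive-QFT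
result; it is NOT the continuum limit and NOT the Clay problem.»  HONEST DEPENDENCY (verbatim): «continuum YM on T⁴ ⇐ BetaPertH ∧ nine spine
estimates (0/9 proved); BetaPertH ⇐ (D1) ∧ (D4) ∧ CAP+tail; G-an2-4 gates asym, D1 and NE2/3/4.»  [our object] data definitions (`seg1`, `corner`,
`pathInd`, `MW`) and [folklore] lattice-path ∕ Kronecker algebra; an1's `hessFFAt` (node 7aρ) and its localisation ∕ translation laws BY NAME.  No statement of
Bałaban's papers, no `[cite:]`, no `def … : Prop`; `MW` is a MODEL of a typed socket, NOT Bałaban's second-order mixed averaging jet `mixFFAt`; instantiates NO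
binder of the β-function wall (0/4: hW, hR, D1Tel, D1Rep).  NOT hW, NOT hR, NOT D1, NOT `BetaPertH`, NOT continuum, NOT Clay.

WHAT (`d + 1 = 4`, centred root `ρ_c = toSite (ctrOff 4 Lc)`, `H_{ρ′w} := hessFFAt ρ_c Lc ρ′ w`, block root `r_w := Lc•w + ρ_c`).  The hW level-0 mixed Ward
letter (W-M₀) (`WardLocusParityLevels.…_TW_su_exact₀`'s hM₂0) asks for a table whose BLOCK WARD DIVERGENCE in the fluctuation slot is the commutator
datum: `(stepScale 0·Lc⁴)⁻¹ • Σ_{v∈box} divV (κ u ↦ M2Of 3 Lc M 0 κ u ρ′ w) (Lc•Y + v) = [M1At 0 ρ′ w, D_Y]`, `D_Y = diagK (½ • Σ_v legInd ρ_c (Lc•Y + v))`.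
Part A (`WardMixedModelNoGo`) showed the owner's hR model `Mmodel` fails it.  HERE: a table that satisfies it (and — part C2 — seeds a JOINT hR∕hW model).
* §1 the SIGNED INDICATOR `pathInd a b κ u` of the axial lattice path `a → b` (axis 0 first, then 1, 2, 3) on the fine bond `(κ, u)`; **`pathInd_div`**:
  its divergence is `[b = s] − [a = s]`; `abs_pathInd_le`, support `l1_le_of_pathInd_ne_zero` (`|u − a|₁ ≤ |b − a|₁`), translation invariance.
* §2 **`MW Lc cΛ κ u ρ′ w := conjV (cΛ • H_{ρ′w}) (diagK (p ↦ ½Lc⁴ · pathInd r_w p κ u))`** — a diagonal-gauge conjugate of the first-order table by the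
  potential of a unit flux carried from the block root `r_w` to the leg site; `MW_apply`; **`ward_MW`**: (W-M₀) holds EXACTLY (residual `0`): the flux
  from `r_w` to `p` has block divergence `½([p ∈ B(Y)] − [Y = w])`, and the constant `[Y = w]` commutes away.
* §3 **`locStencilFM_MW`** (`LocStencilFM` class, rate `1∕5`: the path stays in the `ℓ¹`-ball of its endpoint around `r_w`, `biLoc_hessFFAt_root`) and
  **`MW_translate`** (block translation: the root moves with `w`).
Provenance: D1 formalisation swarm, leaf prover 06 (gen 4), 2026-08-20; no existing file touched.
-/

noncomputable section

open Finset
open scoped BigOperators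
open Literature.MathematicalPhysics.QuantumFieldTheory
open Literature.MathematicalPhysics.QuantumFieldTheory.Balaban1983to89
open Literature.MathematicalPhysics.QuantumFieldTheory.Balaban1983to89.Beta
open B12Sec2to5 (l1 l1_nonneg)
open ExpKernelCalculus (MKer comp BiLoc shiftK l1_sub_triangle)
open KernelWard (divV biLoc_recentre)
open AffineAveraging (Site box toSite unitVec unitVec_apply)
open AveragingContoursRooted (ctr ctrOff ctrOff_mem_box)
open AveragingHessianKernelsRooted (hessFFAt hessFFAt_inl_inl hessFFAt_inl_inr hessFFAt_inr hessFFAt_translate biLoc_hessFFAt_root)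
open OneStepResolventKernel (Fib)
open OneStepKernelFamily (l1_neg_eq)
open BalabanStepW2 (M2Of wM1 wM2)
open SecondOrderResponse (LocStencilFM)
open StepJetData (biLoc_weaken biLoc_smul)
open Summit.QuantumFields.BalabanUV.Beta.TameKernelCalculus
open Summit.QuantumFields.BalabanUV.Beta.ChartConjugation (conjV)
open Summit.QuantumFields.BalabanUV.Beta.BorderedHessian (diagK conjV_diagK_apply stepScale)
open Summit.QuantumFields.BalabanUV.Beta.AveragingWardRootedStencils (legInd legInd_inl)
open Summit.QuantumFields.BalabanUV.Beta.SpineRooted (M1At)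
open Summit.QuantumFields.BalabanUV.Beta.KernelWardLevels (stepScale_zero)
open Summit.QuantumFields.BalabanUV.Beta.WardBorderReflection (unitVec_eq)
open Summit.QuantumFields.BalabanUV.Beta.WardMixedConsistency (datum_apply_eq_zero)

namespace Summit.QuantumFields.BalabanUV.Beta.WardMixedWardModel

/-! ## §1 The signed indicator of the axial lattice path `a → b` -/

/-- [our object] The signed indicator of the directed integer interval from `lo` to `hi`, read at the unit step `[t, t+1]`:
`+1` if `lo ≤ t < hi`, `−1` if `hi ≤ t < lo`, `0` otherwise. -/
def seg1 (lo hi t : ℤ) : ℝ := (if lo ≤ t ∧ t < hi then 1 else 0) - (if hi ≤ t ∧ t < lo then 1 else 0)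

/-- [folklore] **1-D TELESCOPING**: `seg1 lo hi (t − 1) − seg1 lo hi t = [hi = t] − [lo = t]`. -/
theorem seg1_sub (lo hi t : ℤ) : seg1 lo hi (t - 1) - seg1 lo hi t = (if hi = t then 1 else 0) - (if lo = t then 1 else 0) := by
  simp only [seg1]
  split_ifs <;> norm_num <;> omega

/-- [folklore] `|seg1| ≤ 1`. -/
theorem abs_seg1_le (lo hi t : ℤ) : |seg1 lo hi t| ≤ 1 := by
  simp only [seg1]
  split_ifs <;> norm_num

/-- [folklore] `seg1 ≠ 0` only between the endpoints: `|t − lo| ≤ |hi − lo|`. -/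
theorem abs_le_of_seg1_ne_zero {lo hi t : ℤ} (h : seg1 lo hi t ≠ 0) : |((t - lo : ℤ) : ℝ)| ≤ |((hi - lo : ℤ) : ℝ)| := by
  simp only [seg1] at h
  rw [← Int.cast_abs, ← Int.cast_abs, Int.cast_le]
  split_ifs at h with h1 h2 h2
  · omega
  · rw [abs_of_nonneg (by omega), abs_of_pos (by omega)]; omega
  · rw [abs_of_nonpos (by omega), abs_of_neg (by omega)]; omega
  · exact absurd (by norm_num) h

/-- [folklore] `seg1` is translation invariant. -/
theorem seg1_add (lo hi t v : ℤ) : seg1 (lo + v) (hi + v) (t + v) = seg1 lo hi t := by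
  simp only [seg1, add_le_add_iff_right, add_lt_add_iff_right]

/-- [our object] The corners of the axial path from `a` to `b`: `corner a b i` has the coordinates `< i` of `b` and the coordinates `≥ i` of `a`
(`corner a b 0 = a`, `corner a b 4 = b`). -/
def corner (a b : Fin (3 + 1) → ℤ) (i : ℕ) : Fin (3 + 1) → ℤ := fun j => if (j : ℕ) < i then b j else a j

/-- [our object] **THE SIGNED INDICATOR OF THE AXIAL LATTICE PATH `a → b`** on the fine bond `(κ, u)` (the bond `[u, u + e_κ]`): the path runs from
`corner a b κ` to `corner a b (κ+1)` along axis `κ`; `+1` if traversed forwards, `−1` backwards, `0` off the path. -/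
def pathInd (a b : Fin (3 + 1) → ℤ) (κ : Fin (3 + 1)) (u : Fin (3 + 1) → ℤ) : ℝ :=
  if (∀ j : Fin (3 + 1), j ≠ κ → u j = corner a b κ j) then seg1 (a κ) (b κ) (u κ) else 0

/-- [folklore] `corner a b 0 = a`. -/
theorem corner_zero (a b : Fin (3 + 1) → ℤ) : corner a b 0 = a := by
  funext j; simp [corner]

/-- [folklore] `corner a b 4 = b`. -/
theorem corner_four (a b : Fin (3 + 1) → ℤ) : corner a b (3 + 1) = b := by
  funext j; simp [corner, j.isLt]

/-- [folklore] On the axis-`κ` line of the path, the far corner is reached exactly when `u κ = b κ`. -/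
theorem eq_corner_succ_iff {a b u : Fin (3 + 1) → ℤ} {κ : Fin (3 + 1)} (hC : ∀ j : Fin (3 + 1), j ≠ κ → u j = corner a b κ j) :
    corner a b ((κ : ℕ) + 1) = u ↔ b κ = u κ := by
  constructor
  · intro h
    have := congrFun h κ
    simp only [corner, Nat.lt_succ_self, if_true] at this
    exact this
  · intro h
    funext j
    by_cases hj : j = κ
    · subst hj; simp [corner, h]
    · rw [hC j hj]
      simp only [corner]
      have hne : (j : ℕ) ≠ (κ : ℕ) := fun e => hj (Fin.ext e)
      by_cases hlt : (j : ℕ) < (κ : ℕ)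
      · rw [if_pos hlt, if_pos (by omega)]
      · rw [if_neg hlt, if_neg (by omega)]

/-- [folklore] … and the near corner exactly when `u κ = a κ`. -/
theorem eq_corner_iff {a b u : Fin (3 + 1) → ℤ} {κ : Fin (3 + 1)} (hC : ∀ j : Fin (3 + 1), j ≠ κ → u j = corner a b κ j) :
    corner a b (κ : ℕ) = u ↔ a κ = u κ := by
  constructor
  · intro h
    have := congrFun h κ
    simp only [corner, lt_irrefl, if_false] at this
    exact this
  · intro h
    funext j
    by_cases hj : j = κ
    · subst hj; simp [corner, h]
    · exact (hC j hj).symm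

/-- [folklore] Off the axis-`κ` line neither corner is `u`. -/
theorem ne_corner_of_not {a b u : Fin (3 + 1) → ℤ} {κ : Fin (3 + 1)} (hC : ¬ ∀ j : Fin (3 + 1), j ≠ κ → u j = corner a b κ j) :
    corner a b ((κ : ℕ) + 1) ≠ u ∧ corner a b (κ : ℕ) ≠ u := by
  constructor
  · intro h; apply hC; intro j hj
    have := congrFun h j
    simp only [corner] at this ⊢
    have hne : (j : ℕ) ≠ (κ : ℕ) := fun e => hj (Fin.ext e)
    by_cases hlt : (j : ℕ) < (κ : ℕ)
    · rw [if_pos hlt]; rw [if_pos (by omega)] at this; exact this.symm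
    · rw [if_neg hlt]; rw [if_neg (by omega)] at this; exact this.symm
  · intro h; apply hC; intro j _
    exact (congrFun h j).symm

/-- [folklore] **THE DIVERGENCE OF THE PATH INDICATOR, AXIS BY AXIS**: `pathInd a b κ (s − e_κ) − pathInd a b κ s = [corner (κ+1) = s] − [corner κ = s]`. -/
theorem pathInd_sub (a b : Fin (3 + 1) → ℤ) (κ : Fin (3 + 1)) (s : Fin (3 + 1) → ℤ) :
    pathInd a b κ (s - unitVec κ) - pathInd a b κ s =
      (if corner a b ((κ : ℕ) + 1) = s then 1 else 0) - (if corner a b (κ : ℕ) = s then 1 else 0) := by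
  have hcoord : ∀ j : Fin (3 + 1), j ≠ κ → (s - unitVec κ) j = s j := fun j hj => by simp [unitVec_apply, hj]
  have hκ : (s - unitVec κ) κ = s κ - 1 := by simp [unitVec_apply]
  by_cases hC : ∀ j : Fin (3 + 1), j ≠ κ → s j = corner a b κ j
  · have hC' : ∀ j : Fin (3 + 1), j ≠ κ → (s - unitVec κ) j = corner a b κ j := fun j hj => (hcoord j hj).trans (hC j hj)
    simp only [pathInd, if_pos hC, if_pos hC', hκ, seg1_sub, eq_corner_succ_iff hC, eq_corner_iff hC]
  · have hC' : ¬ ∀ j : Fin (3 + 1), j ≠ κ → (s - unitVec κ) j = corner a b κ j :=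
      fun h => hC fun j hj => (hcoord j hj).symm.trans (h j hj)
    obtain ⟨h1, h2⟩ := ne_corner_of_not hC
    simp only [pathInd, if_neg hC, if_neg hC', if_neg h1, if_neg h2, sub_zero]

/-- [folklore] **THE DIVERGENCE OF THE PATH INDICATOR IS `[b = s] − [a = s]`** (the four axis terms telescope through the corners). -/
theorem pathInd_div (a b s : Fin (3 + 1) → ℤ) :
    ∑ κ : Fin (3 + 1), (pathInd a b κ (s - unitVec κ) - pathInd a b κ s) = (if b = s then 1 else 0) - (if a = s then 1 else 0) := by
  simp only [pathInd_sub]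
  rw [Fin.sum_univ_four]
  simp only [show ((0 : Fin (3 + 1)) : ℕ) = 0 from rfl, show ((1 : Fin (3 + 1)) : ℕ) = 1 from rfl, show ((2 : Fin (3 + 1)) : ℕ) = 2 from rfl,
    show ((3 : Fin (3 + 1)) : ℕ) = 3 from rfl, Nat.reduceAdd, corner_zero, corner_four]
  ring

/-- [folklore] `|pathInd| ≤ 1`. -/
theorem abs_pathInd_le (a b : Fin (3 + 1) → ℤ) (κ : Fin (3 + 1)) (u : Fin (3 + 1) → ℤ) : |pathInd a b κ u| ≤ 1 := by
  unfold pathInd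
  split_ifs
  · exact abs_seg1_le _ _ _
  · simp

/-- [folklore] **THE PATH STAYS IN THE `ℓ¹`-BALL OF ITS ENDPOINT**: `pathInd a b κ u ≠ 0 → |u − a|₁ ≤ |b − a|₁`. -/
theorem l1_le_of_pathInd_ne_zero {a b : Fin (3 + 1) → ℤ} {κ : Fin (3 + 1)} {u : Fin (3 + 1) → ℤ} (h : pathInd a b κ u ≠ 0) :
    l1 (u - a) ≤ l1 (b - a) := by
  unfold pathInd at h
  split_ifs at h with hC
  · refine Finset.sum_le_sum fun j _ => ?_
    rw [Pi.sub_apply, Pi.sub_apply]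
    by_cases hj : j = κ
    · subst hj; exact_mod_cast abs_le_of_seg1_ne_zero h
    · rw [hC j hj]
      simp only [corner]
      split_ifs
      · exact le_rfl
      · simp
  · exact absurd rfl h

/-- [folklore] The path indicator is translation invariant. -/
theorem pathInd_add (a b u v : Fin (3 + 1) → ℤ) (κ : Fin (3 + 1)) : pathInd (a + v) (b + v) κ (u + v) = pathInd a b κ u := by
  have hc : ∀ i j, corner (a + v) (b + v) i j = corner a b i j + v j := fun i j => by
    simp only [corner, Pi.add_apply]; split_ifs <;> rfl
  have hiff : (∀ j : Fin (3 + 1), j ≠ κ → (u + v) j = corner (a + v) (b + v) κ j) ↔ (∀ j : Fin (3 + 1), j ≠ κ → u j = corner a b κ j) := by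
    simp only [hc, Pi.add_apply, add_left_inj]
  simp only [pathInd]
  simp only [hiff]
  simp only [Pi.add_apply, seg1_add]

/-! ## §2 The tree-gauge Ward model `MW` and its exact Ward law -/

section Model

variable (Lc : ℕ) (cΛ : ℝ)

/-- [our object] **THE WARD MODEL OF THE MIXED SOCKET**: `MW κ u ρ′ w := conjV (cΛ • H_{ρ′w}) (diagK (p ↦ ½Lc⁴ · pathInd r_w p κ u))`, `r_w = Lc•w + ρ_c`
— the first-order mixed table conjugated by the potential of a unit flux carried from the block root `r_w` to the leg site along the axial path. -/
def MW : Fin (3 + 1) → (Fin (3 + 1) → ℤ) → Fin (3 + 1) → (Fin (3 + 1) → ℤ) → MKer (3 + 1) (Fib 3) :=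
  fun κ u ρ' w => conjV (cΛ • hessFFAt (toSite (ctrOff 4 Lc)) Lc ρ' w)
    (diagK fun p _ => (Lc : ℝ) ^ 4 / 2 * pathInd ((Lc : ℤ) • w + toSite (ctrOff 4 Lc)) p κ u)

variable {Lc cΛ}

/-- [folklore] Entries of `MW`: `cΛ · H x z a b · ½Lc⁴ · (pathInd r_w z κ u − pathInd r_w x κ u)`. -/
theorem MW_apply (κ : Fin (3 + 1)) (u : Fin (3 + 1) → ℤ) (ρ' : Fin (3 + 1)) (w x z : Fin (3 + 1) → ℤ) (a b : Fib 3) :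
    MW Lc cΛ κ u ρ' w x z a b = cΛ * hessFFAt (toSite (ctrOff 4 Lc)) Lc ρ' w x z a b *
      ((Lc : ℝ) ^ 4 / 2 * pathInd ((Lc : ℤ) • w + toSite (ctrOff 4 Lc)) z κ u -
        (Lc : ℝ) ^ 4 / 2 * pathInd ((Lc : ℤ) • w + toSite (ctrOff 4 Lc)) x κ u) := by
  show conjV _ _ x z a b = _
  rw [conjV_diagK_apply, Pi.smul_apply, Pi.smul_apply, Pi.smul_apply, Pi.smul_apply, smul_eq_mul]

/-- [folklore] **THE BLOCK WARD DIVERGENCE OF `MW`, EVERY ENTRY**: `(cΛ∕2) · H_{ρ′w} x z a b · (Σ_v [z = Lc•Y + v] − Σ_v [x = Lc•Y + v])`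
(`pathInd_div`: the flux from `r_w` to `p` has divergence `[p = s] − [r_w = s]`; the root term is the same for both legs and cancels). -/
theorem wardOp_MW_apply (hLc : 1 ≤ Lc) (Y : Fin (3 + 1) → ℤ) (ρ' : Fin (3 + 1)) (w x z : Fin (3 + 1) → ℤ) (a b : Fib 3) :
    ((stepScale 3 Lc 0 * (Lc : ℝ) ^ (3 + 1))⁻¹ • ∑ v ∈ box (3 + 1) Lc,
        divV (fun κ u => wM2 3 Lc 0 • MW Lc cΛ κ u ρ' w) ((Lc : ℤ) • Y + toSite v)) x z a b =
      cΛ / 2 * hessFFAt (toSite (ctrOff 4 Lc)) Lc ρ' w x z a b *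
        ((∑ v ∈ box (3 + 1) Lc, (if z = (Lc : ℤ) • Y + toSite v then (1 : ℝ) else 0)) -
          ∑ v ∈ box (3 + 1) Lc, (if x = (Lc : ℤ) • Y + toSite v then (1 : ℝ) else 0)) := by
  have hL : (Lc : ℝ) ≠ 0 := by exact_mod_cast (show Lc ≠ 0 by omega)
  have h0 : wM2 3 Lc 0 = 1 := by simp [BalabanStepW2.wM2]
  set r := (Lc : ℤ) • w + toSite (ctrOff 4 Lc) with hr
  set H := hessFFAt (toSite (ctrOff 4 Lc)) Lc ρ' w x z a b with hH
  -- the fine divergence at one site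
  have hdiv : ∀ s : Fin (3 + 1) → ℤ, divV (fun κ u => wM2 3 Lc 0 • MW Lc cΛ κ u ρ' w) s x z a b =
      cΛ * H * ((Lc : ℝ) ^ 4 / 2) * ((if z = s then (1 : ℝ) else 0) - (if x = s then (1 : ℝ) else 0)) := by
    intro s
    simp only [KernelWard.divV, Finset.sum_apply, Pi.sub_apply, Pi.smul_apply, smul_eq_mul, h0, one_mul, MW_apply, unitVec_eq]
    have e : ∀ κ : Fin (3 + 1), cΛ * H * ((Lc : ℝ) ^ 4 / 2 * pathInd r z κ (s - unitVec κ) - (Lc : ℝ) ^ 4 / 2 * pathInd r x κ (s - unitVec κ)) -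
        cΛ * H * ((Lc : ℝ) ^ 4 / 2 * pathInd r z κ s - (Lc : ℝ) ^ 4 / 2 * pathInd r x κ s) =
        cΛ * H * ((Lc : ℝ) ^ 4 / 2) * ((pathInd r z κ (s - unitVec κ) - pathInd r z κ s) - (pathInd r x κ (s - unitVec κ) - pathInd r x κ s)) :=
      fun κ => by ring
    rw [Finset.sum_congr rfl fun κ _ => e κ, ← Finset.mul_sum, Finset.sum_sub_distrib, pathInd_div, pathInd_div]
    by_cases hz : z = s <;> by_cases hx : x = s <;> by_cases hr' : r = s <;> simp [hz, hx, hr']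
  rw [Pi.smul_apply, Pi.smul_apply, Pi.smul_apply, Pi.smul_apply, smul_eq_mul, Finset.sum_apply, Finset.sum_apply,
    Finset.sum_apply, Finset.sum_apply]
  simp only [hdiv, stepScale_zero, one_mul]
  rw [← Finset.mul_sum, Finset.sum_sub_distrib]
  have h4 : (Lc : ℝ) ^ (3 + 1) = (Lc : ℝ) ^ 4 := by norm_num
  rw [h4]
  field_simp

end Model

section Law

variable {Lc : ℕ} {cΛ : ℝ}

/-- [folklore] **THE WARD MODEL SATISFIES (W-M₀) EXACTLY** (`1 ≤ Lc`; residual `0`): for all `Y ρ′ w`,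
`(stepScale 0·Lc⁴)⁻¹ • Σ_v divV (κ u ↦ wM2 0 • MW κ u ρ′ w) (Lc•Y + v) = [M1At 0 ρ′ w, D_Y]`, `D_Y = diagK (½ • Σ_v legInd ρ_c (Lc•Y + v))`
(`M2Of 3 Lc MW 0 κ u ρ′ w` is `wM2 0 • MW κ u ρ′ w` by `rfl`, so this is hM₂0 of `WardLocusParityLevels.…_TW_su_exact₀` at `mixFF := MW`, `RM₀ := 0`). -/
theorem ward_MW (hLc : 1 ≤ Lc) (Y : Fin (3 + 1) → ℤ) (ρ' : Fin (3 + 1)) (w : Fin (3 + 1) → ℤ) :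
    (stepScale 3 Lc 0 * (Lc : ℝ) ^ (3 + 1))⁻¹ • ∑ v ∈ box (3 + 1) Lc,
        divV (fun κ u => wM2 3 Lc 0 • MW Lc cΛ κ u ρ' w) ((Lc : ℤ) • Y + toSite v) =
      comp (M1At 3 Lc (toSite (ctrOff (3 + 1) Lc)) cΛ 0 ρ' w)
          (diagK (((1 : ℝ) / 2) • ∑ v ∈ box (3 + 1) Lc, legInd (toSite (ctrOff (3 + 1) Lc)) ((Lc : ℤ) • Y + toSite v))) -
        comp (diagK (((1 : ℝ) / 2) • ∑ v ∈ box (3 + 1) Lc, legInd (toSite (ctrOff (3 + 1) Lc)) ((Lc : ℤ) • Y + toSite v)))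
          (M1At 3 Lc (toSite (ctrOff (3 + 1) Lc)) cΛ 0 ρ' w) := by
  funext x z a b
  rw [wardOp_MW_apply hLc]
  rcases a with β | m <;> rcases b with β' | m'
  · rw [WardMixedModelNoGo.mixedDatum_inl_inl]; ring
  · have hab : ∀ (w' x' z' : Fin (3 + 1) → ℤ), hessFFAt (toSite (ctrOff 4 Lc)) Lc ρ' w' x' z' (Sum.inl β) (Sum.inr m') = 0 :=
      fun w' x' z' => hessFFAt_inl_inr _ _ _ _ _ _ _ _
    rw [datum_apply_eq_zero cΛ Y ρ' w x z hab, hab]; ring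
  · have hab : ∀ (w' x' z' : Fin (3 + 1) → ℤ), hessFFAt (toSite (ctrOff 4 Lc)) Lc ρ' w' x' z' (Sum.inr m) (Sum.inl β') = 0 :=
      fun w' x' z' => hessFFAt_inr _ _ _ _ _ _ _ _
    rw [datum_apply_eq_zero cΛ Y ρ' w x z hab, hab]; ring
  · have hab : ∀ (w' x' z' : Fin (3 + 1) → ℤ), hessFFAt (toSite (ctrOff 4 Lc)) Lc ρ' w' x' z' (Sum.inr m) (Sum.inr m') = 0 :=
      fun w' x' z' => hessFFAt_inr _ _ _ _ _ _ _ _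
    rw [datum_apply_eq_zero cΛ Y ρ' w x z hab, hab]; ring

end Law

/-! ## §3 Class and block translation of the Ward model -/

section Class

variable {Lc : ℕ} {cΛ : ℝ}

/-- [folklore] **THE WARD MODEL IS BLOCK-TRANSLATION COVARIANT** (`hmixt`): the root `r_w` moves with `w` (`hessFFAt_translate`, `pathInd_add`). -/
theorem MW_translate (κ : Fin (3 + 1)) (u : Fin (3 + 1) → ℤ) (μ : Fin (3 + 1)) (w t : Fin (3 + 1) → ℤ) :
    MW Lc cΛ κ (u + (Lc : ℤ) • t) μ (w + t) = shiftK (-((Lc : ℤ) • t)) (MW Lc cΛ κ u μ w) := by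
  have hr : (Lc : ℤ) • (w + t) + toSite (ctrOff 4 Lc) = ((Lc : ℤ) • w + toSite (ctrOff 4 Lc)) + (Lc : ℤ) • t := by
    rw [smul_add]; abel
  have hp : ∀ p : Fin (3 + 1) → ℤ, pathInd (((Lc : ℤ) • w + toSite (ctrOff 4 Lc)) + (Lc : ℤ) • t) p κ (u + (Lc : ℤ) • t) =
      pathInd ((Lc : ℤ) • w + toSite (ctrOff 4 Lc)) (p + -((Lc : ℤ) • t)) κ u := fun p => by
    conv_lhs => rw [show p = (p + -((Lc : ℤ) • t)) + (Lc : ℤ) • t by abel]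
    exact pathInd_add _ _ _ _ _
  funext x z a b
  simp only [MW_apply, ExpKernelCalculus.shiftK, hr, hp, hessFFAt_translate]

/-- [folklore] **THE WARD MODEL IS A `LocStencilFM` FAMILY** (`hmix`; rate `1∕5`): on the support of `pathInd r_w p κ u` the bond `u` lies in the `ℓ¹`-ball
`|u − r_w| ≤ |p − r_w|`, `p ∈ {x, z}`, and `H_{ρ′w}` is bi-localised at `r_w` (`biLoc_hessFFAt_root`, rate `1`); the triangle inequality trades
`e^{−(|x−r|+|z−r|)}` for `e^{|ρ_c|∕5} · e^{−(|u − Lc•w| + |x−u| + |z−u|)∕5}`. -/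
theorem locStencilFM_MW (hLc : 1 ≤ Lc) (cΛ : ℝ) : ∃ C δ : ℝ, 0 < δ ∧ LocStencilFM Lc (MW Lc cΛ) C δ := by
  set CH : ℝ := 2 * (AveragingHessianKernels.ell (3 + 1) Lc : ℝ) ^ 2 * Real.exp (4 * ((3 : ℝ) + 1) * Lc * 1) with hCH
  have hCH0 : 0 ≤ CH := by positivity
  refine ⟨|cΛ| * CH * (Lc : ℝ) ^ 4 * Real.exp (l1 (toSite (ctrOff 4 Lc) : Fin (3 + 1) → ℤ) / 5), 1 / 5, by norm_num, ?_⟩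
  intro κ u μ w x z a b
  set r := (Lc : ℤ) • w + toSite (ctrOff 4 Lc) with hr
  have hH : BiLoc (hessFFAt (toSite (ctrOff 4 Lc)) Lc μ w) r r CH 1 :=
    biLoc_hessFFAt_root (d := 3) hLc μ w (ctrOff_mem_box hLc) zero_le_one
  have hHb := hH x z a b
  rw [MW_apply]
  set H := hessFFAt (toSite (ctrOff 4 Lc)) Lc μ w x z a b with hHdef
  set Pz := pathInd r z κ u with hPz
  set Px := pathInd r x κ u with hPx
  have hPz1 := abs_pathInd_le r z κ u
  have hPx1 := abs_pathInd_le r x κ u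
  -- the trivial case: both path indicators vanish
  by_cases h0 : Pz = 0 ∧ Px = 0
  · rw [h0.1, h0.2, mul_zero, sub_self, mul_zero, abs_zero]; positivity
  -- otherwise `u` is in the ℓ¹-ball: `|u − r| ≤ |x − r| + |z − r| =: S`
  have hS : l1 (u - r) ≤ l1 (x - r) + l1 (z - r) := by
    rcases not_and_or.1 h0 with hz | hx
    · exact (l1_le_of_pathInd_ne_zero hz).trans (le_add_of_nonneg_left (l1_nonneg _))
    · exact (l1_le_of_pathInd_ne_zero hx).trans (le_add_of_nonneg_right (l1_nonneg _))
  have t1 : l1 (x - u) ≤ l1 (x - r) + l1 (u - r) := by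
    have := l1_sub_triangle x r u; rw [← l1_neg_eq (u - r), neg_sub]; exact this
  have t2 : l1 (z - u) ≤ l1 (z - r) + l1 (u - r) := by
    have := l1_sub_triangle z r u; rw [← l1_neg_eq (u - r), neg_sub]; exact this
  have t3 : l1 (u - (Lc : ℤ) • w) ≤ l1 (u - r) + l1 (toSite (ctrOff 4 Lc) : Fin (3 + 1) → ℤ) := by
    have := l1_sub_triangle u r ((Lc : ℤ) • w)
    rw [show r - (Lc : ℤ) • w = toSite (ctrOff 4 Lc) by rw [hr]; abel] at this
    exact this
  have hexp : Real.exp (-(1 : ℝ) * (l1 (x - r) + l1 (z - r))) ≤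
      Real.exp (l1 (toSite (ctrOff 4 Lc) : Fin (3 + 1) → ℤ) / 5) * (Real.exp (-(1 / 5) * l1 (u - (Lc : ℤ) • w)) *
        Real.exp (-(1 / 5) * (l1 (x - u) + l1 (z - u)))) := by
    rw [← Real.exp_add, ← Real.exp_add]
    exact Real.exp_le_exp.2 (by nlinarith [l1_nonneg (u - r)])
  have hmain : |H| * ((Lc : ℝ) ^ 4 / 2 * |Pz| + (Lc : ℝ) ^ 4 / 2 * |Px|) ≤ CH * Real.exp (-(1 : ℝ) * (l1 (x - r) + l1 (z - r))) * (Lc : ℝ) ^ 4 := by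
    have h1 : (Lc : ℝ) ^ 4 / 2 * |Pz| + (Lc : ℝ) ^ 4 / 2 * |Px| ≤ (Lc : ℝ) ^ 4 := by nlinarith [pow_nonneg (Nat.cast_nonneg Lc : (0 : ℝ) ≤ Lc) 4]
    exact mul_le_mul hHb h1 (by positivity) (by positivity)
  calc |cΛ * H * ((Lc : ℝ) ^ 4 / 2 * Pz - (Lc : ℝ) ^ 4 / 2 * Px)|
      = |cΛ| * (|H| * |(Lc : ℝ) ^ 4 / 2 * Pz - (Lc : ℝ) ^ 4 / 2 * Px|) := by rw [abs_mul, abs_mul, mul_assoc]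
    _ ≤ |cΛ| * (|H| * ((Lc : ℝ) ^ 4 / 2 * |Pz| + (Lc : ℝ) ^ 4 / 2 * |Px|)) := by
        refine mul_le_mul_of_nonneg_left (mul_le_mul_of_nonneg_left ?_ (abs_nonneg _)) (abs_nonneg _)
        refine (abs_sub _ _).trans ?_
        rw [abs_mul, abs_mul, abs_of_nonneg (by positivity : (0 : ℝ) ≤ (Lc : ℝ) ^ 4 / 2)]
    _ ≤ |cΛ| * (CH * Real.exp (-(1 : ℝ) * (l1 (x - r) + l1 (z - r))) * (Lc : ℝ) ^ 4) := mul_le_mul_of_nonneg_left hmain (abs_nonneg _)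
    _ ≤ |cΛ| * (CH * (Real.exp (l1 (toSite (ctrOff 4 Lc) : Fin (3 + 1) → ℤ) / 5) * (Real.exp (-(1 / 5) * l1 (u - (Lc : ℤ) • w)) *
          Real.exp (-(1 / 5) * (l1 (x - u) + l1 (z - u))))) * (Lc : ℝ) ^ 4) := by
        refine mul_le_mul_of_nonneg_left (mul_le_mul_of_nonneg_right (mul_le_mul_of_nonneg_left hexp hCH0) (by positivity))
          (abs_nonneg _)
    _ = |cΛ| * CH * (Lc : ℝ) ^ 4 * Real.exp (l1 (toSite (ctrOff 4 Lc) : Fin (3 + 1) → ℤ) / 5) *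
          Real.exp (-(1 / 5) * l1 (u - (Lc : ℤ) • w)) * Real.exp (-(1 / 5) * (l1 (x - u) + l1 (z - u))) := by ring

end Class

end Summit.QuantumFields.BalabanUV.Beta.WardMixedWardModel

end
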